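import Summits.ResolutionOfSingularities.ResolutionOfSingularities.Theorems.FrobeniusClosingPatchingRelPerfectDepthSNCPointwise
import Literature.AlgebraicGeometry.Resolution.CoefficientIdealRestriction
import Literature.AlgebraicGeometry.Resolution.MarkedIdealsEtale
import Literature.AlgebraicGeometry.Resolution.RegularLocalRingsQuotient
import Literature.AlgebraicGeometry.Resolution.PointBlowupHsFunMono
import Literature.AlgebraicGeometry.Resolution.BlowupDisjointCentreWeights
import HarnessLib

/-!
# Crux `PatchingRelPerfect` (stmt-ResolutionOfSingularities-16161), chain W5.2 — T6-E1b residual `LegalScopedDivisorReduction₃`,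
# PHASE 2 closer (2b), spec D4 (c): TRANSVERSAL TRACES LIFT — host + boundary are snc at a point where the TRACES are snc

[OURS · L1 W5.2 · res-L1-w52-lead-1 g5, hand #3b; spec `L/res-L1-w52-lead-1/PHASE2-STEPB-SPEC.md` §D4 refined (c)] Replaces the role of NO
printed item; NOT a statement of the manuscript under review; fact-free.

The local algebra behind the SIMPLE-CURVE case of the oracle: at a point `x` of the host `X = V(D)` (`ι : X ↪ E`, `D_{ι x} = (z)`,
`z ∉ 𝔪²`) where the TRACES `F|_X = F.comap ι` of the boundary members form a simple-normal-crossings family ON `X` (each member through `x`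
cuts `X` in ONE reduced regular branch, the branches pairwise transversal), the family `D :: ℬ` has simple normal crossings at `ι x` ON `E`:
lift the adapted parameters `ū` of `𝒪_{X,x} = 𝒪_{E,ι x}/(z)` to `𝒪_{E,ι x}`, replace the lift labelled by a member `F` by `F`'s own equation
`f` (`f ≡ unit · ū_j mod z`), and prepend `z` (Matsumura 14.2: `emb dim 𝒪_X + 1 = emb dim 𝒪_E`).

* `sncWithAt_cons_host_of_traces` — the statement above. With `SNCWithAt.centre_of_members` (…DepthLegalCurveCentre) it gives the
  normal crossings of a simple trace curve `Γ = X ∩ F₁` (`𝓘(Γ)_x = (z) + (f₁)`) with the boundary.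

AI-written; AI review is weaker than expert review.

## References
* H. Matsumura, *Commutative Ring Theory* (1986), Thm. 14.2. [Matsumura1987]
* E. Bierstone, D. Grigoriev, P. Milman, J. Włodarczyk, arXiv:1206.3090, Def. 3.1.1. [BierstoneGrigorievMilmanWlodarczyk2011]
-/

-- `Summit.<Summit>.<Sub>.Theorems` with `Sub = Summit` (single-conjunct summit, D-0017)
set_option linter.dupNamespace false

noncomputable section

open CategoryTheory CategoryTheory.Limits AlgebraicGeometry TopologicalSpace IsLocalRing
open Literature.AlgebraicGeometry.Resolution Scheme.IdealSheafData

namespace Summit.ResolutionOfSingularities.ResolutionOfSingularities.Theorems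

universe u

namespace DepthLegal

open DepthSNC

variable {E : Scheme.{u}} {D : E.IdealSheafData}

/-- [OURS · L1 W5.2] **TRANSVERSAL TRACES LIFT.** Let `x` be a point of the host `X = V(D)` with `D_{ι x} = (z)`, `z ∉ 𝔪²`, `𝒪_{E,ι x}`
regular, and let `ℬ` be a list of ideal sheaves on `E` whose TRACES `F.comap ι` form a simple-normal-crossings family at `x` on `X`. Then
`D :: ℬ` has simple normal crossings at `ι x`. [cite: Matsumura1987, Thm. 14.2] [cite: BierstoneGrigorievMilmanWlodarczyk2011, Def. 3.1.1] -/
theorem sncWithAt_cons_host_of_traces (x : D.subscheme) [IsRegularLocalRing (E.presheaf.stalk (D.subschemeι x))]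
    {z : E.presheaf.stalk (D.subschemeι x)} (hDx : stalkIdeal D (D.subschemeι x) = Ideal.span {z})
    (hz2 : z ∉ (maximalIdeal (E.presheaf.stalk (D.subschemeι x))) ^ 2) (ℬ : List E.IdealSheafData)
    (hcart : ∀ F ∈ ℬ, D.subschemeι x ∈ F.support → ∃ f, stalkIdeal F (D.subschemeι x) = Ideal.span {f})
    (hinj : ∀ F ∈ ℬ, ∀ F' ∈ ℬ, D.subschemeι x ∈ F.support → D.subschemeι x ∈ F'.support →
      F.comap D.subschemeι = F'.comap D.subschemeι → F = F')
    (htr : SNCWithAt (ℬ.map fun F => F.comap D.subschemeι) ⊤ x) :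
    SNCWithAt (D :: ℬ) ⊤ (D.subschemeι x) := by
  classical
  have hsurj : Function.Surjective (D.subschemeι.stalkMap x).hom := D.subschemeι.stalkMap_surjective x
  have hker : RingHom.ker (D.subschemeι.stalkMap x).hom = Ideal.span {z} := by rw [ker_stalkMap_subschemeι, hDx]
  have hxD : D.subschemeι x ∈ D.support := subschemeι_apply_mem_support D x
  have hzm : z ∈ maximalIdeal (E.presheaf.stalk (D.subschemeι x)) := by
    have h := (mem_support_iff_stalkIdeal_le D _).mp hxD
    rw [hDx, Ideal.span_singleton_le_iff_mem] at h
    exact h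
  obtain ⟨hregX, d, ubar, hd, hubar, ⟨lab, hlab, hlabD⟩, -⟩ := htr
  haveI := hregX
  haveI := isDomain_of_isRegularLocalRing (D.subscheme.presheaf.stalk x)
  -- the trace of a member through `ι x`, as an element of the traces-through-`x` subtype
  let tr : {G : E.IdealSheafData // G ∈ ℬ ∧ D.subschemeι x ∈ G.support} →
      {T : D.subscheme.IdealSheafData // T ∈ ℬ.map (fun F => F.comap D.subschemeι) ∧ x ∈ T.support} :=
    fun G => ⟨G.1.comap D.subschemeι, List.mem_map.mpr ⟨G.1, G.2.1, rfl⟩,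
      (mem_support_comap_iff D.subschemeι G.1 x).mpr G.2.2⟩
  have htr_inj : Function.Injective tr := by
    intro G G' h
    have h1 : G.1.comap D.subschemeι = G'.1.comap D.subschemeι := congrArg (fun T => T.1) h
    exact Subtype.ext (hinj G.1 G.2.1 G'.1 G'.2.1 G.2.2 G'.2.2 h1)
  -- generators of the members through `ι x`, mapping to unit multiples of the trace parameters
  have hgen : ∀ G : {G : E.IdealSheafData // G ∈ ℬ ∧ D.subschemeι x ∈ G.support},
      ∃ f : E.presheaf.stalk (D.subschemeι x), stalkIdeal G.1 (D.subschemeι x) = Ideal.span {f} ∧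
        ∃ a : D.subscheme.presheaf.stalk x, IsUnit a ∧ (D.subschemeι.stalkMap x).hom f = a * ubar (lab (tr G)) := by
    intro G
    obtain ⟨f, hf⟩ := hcart G.1 G.2.1 G.2.2
    refine ⟨f, hf, ?_⟩
    have h1 : stalkIdeal (G.1.comap D.subschemeι) x = Ideal.span {(D.subschemeι.stalkMap x).hom f} := by
      rw [stalkIdeal_comap_eq_map, hf, Ideal.map_span, Set.image_singleton]
    have h2 : stalkIdeal (G.1.comap D.subschemeι) x = Ideal.span {ubar (lab (tr G))} := hlabD (tr G)
    rw [h1, Ideal.span_singleton_eq_span_singleton] at h2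
    obtain ⟨a, ha⟩ := h2.symm
    exact ⟨a, a.isUnit, by rw [← ha, mul_comm]⟩
  choose f hf a ha hfa using hgen
  -- lifts of the trace parameters, replaced by the member equations at the member labels
  choose u hu using fun j => hsurj (ubar j)
  let u' : Fin d → E.presheaf.stalk (D.subschemeι x) := fun j =>
    if h : ∃ G, lab (tr G) = j then f h.choose else u j
  have hu'lab : ∀ G, u' (lab (tr G)) = f G := by
    intro G
    have hex : ∃ G', lab (tr G') = lab (tr G) := ⟨G, rfl⟩
    simp only [u', dif_pos hex]
    congr 1
    exact htr_inj (hlab hex.choose_spec)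
  -- the images of the `u'` generate `𝔪_X` : each is a unit multiple of `ubar j`
  have hφu' : ∀ j, ∃ b : D.subscheme.presheaf.stalk x, IsUnit b ∧ (D.subschemeι.stalkMap x).hom (u' j) = b * ubar j := by
    intro j
    by_cases hex : ∃ G, lab (tr G) = j
    · obtain ⟨G, rfl⟩ := hex
      exact ⟨a G, ha G, by rw [hu'lab, hfa]⟩
    · exact ⟨1, isUnit_one, by simp only [u', dif_neg hex, hu, one_mul]⟩
  have hspanX : Ideal.map (D.subschemeι.stalkMap x).hom (Ideal.span (Set.range u')) = maximalIdeal _ := by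
    rw [Ideal.map_span, ← hubar]
    apply le_antisymm
    · rw [Ideal.span_le]; rintro _ ⟨_, ⟨j, rfl⟩, rfl⟩
      obtain ⟨b, -, hb⟩ := hφu' j
      rw [SetLike.mem_coe, hb]; exact Ideal.mul_mem_left _ _ (Ideal.subset_span ⟨j, rfl⟩)
    · rw [Ideal.span_le]; rintro _ ⟨j, rfl⟩
      obtain ⟨b, hb, hbe⟩ := hφu' j
      obtain ⟨c, rfl⟩ := hb
      have : ubar j = ↑c⁻¹ * (D.subschemeι.stalkMap x).hom (u' j) := by rw [hbe, ← mul_assoc, Units.inv_mul, one_mul]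
      rw [SetLike.mem_coe, this]; exact Ideal.mul_mem_left _ _ (Ideal.subset_span ⟨u' j, ⟨j, rfl⟩, rfl⟩)
  -- `𝔪_E = (z) + (u')`
  have hspanE : Ideal.span (Set.range (Fin.cons z u' : Fin (d + 1) → _)) = maximalIdeal (E.presheaf.stalk (D.subschemeι x)) := by
    rw [Fin.range_cons, Ideal.span_insert]
    apply le_antisymm
    · refine sup_le ((Ideal.span_singleton_le_iff_mem _).mpr hzm) ?_
      rw [Ideal.span_le]; rintro _ ⟨j, rfl⟩
      -- `u' j ∈ 𝔪`: its image is in `𝔪_X` and the stalk map is local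
      have h1 : (D.subschemeι.stalkMap x).hom (u' j) ∈ maximalIdeal _ := by
        rw [← hspanX]; exact Ideal.mem_map_of_mem _ (Ideal.subset_span ⟨j, rfl⟩)
      by_contra hnot
      have hu : IsUnit (u' j) := by
        by_contra hnu
        exact hnot ((IsLocalRing.mem_maximalIdeal _).mpr hnu)
      exact (IsLocalRing.mem_maximalIdeal _).mp h1 (hu.map _)
    · intro m hm
      have h1 : (D.subschemeι.stalkMap x).hom m ∈ Ideal.map (D.subschemeι.stalkMap x).hom (Ideal.span (Set.range u')) := by
        rw [hspanX]
        exact (IsLocalRing.mem_maximalIdeal _).mpr fun hu =>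
          (IsLocalRing.mem_maximalIdeal _).mp hm (IsLocalHom.map_nonunit m hu)
      rw [← Ideal.mem_comap, Ideal.comap_map_of_surjective _ hsurj, ← RingHom.ker_eq_comap_bot, hker] at h1
      rw [sup_comm]; exact h1
  -- the count: `emb dim 𝒪_E = emb dim 𝒪_X + 1`
  have hcount : (maximalIdeal (E.presheaf.stalk (D.subschemeι x))).spanFinrank = d + 1 := by
    let e : (E.presheaf.stalk (D.subschemeι x) ⧸ Ideal.span {z}) ≃+* D.subscheme.presheaf.stalk x :=
      (Ideal.quotEquivOfEq hker.symm).trans (RingHom.quotientKerEquivOfSurjective hsurj)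
    have h1 := (IsRegularLocalRing.quotient_span_singleton hzm hz2).2
    have h2 : ringKrullDim (E.presheaf.stalk (D.subschemeι x) ⧸ Ideal.span {z}) =
        ringKrullDim (D.subscheme.presheaf.stalk x) := ringKrullDim_eq_of_ringEquiv e
    have h3 := IsRegularLocalRing.spanFinrank_maximalIdeal (R := E.presheaf.stalk (D.subschemeι x))
    have h4 := IsRegularLocalRing.spanFinrank_maximalIdeal (R := D.subscheme.presheaf.stalk x)
    rw [hd] at h4
    have h5 : ((maximalIdeal (E.presheaf.stalk (D.subschemeι x))).spanFinrank : WithBot ℕ∞) =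
        ((d + 1 : ℕ) : WithBot ℕ∞) := by
      rw [h3, ← h1, h2, ← h4]; norm_cast
    exact_mod_cast h5
  -- membership of a non-host member of `D :: ℬ` in `ℬ`
  have hmemℬ : ∀ G : {G : E.IdealSheafData // G ∈ D :: ℬ ∧ D.subschemeι x ∈ G.support}, G.1 ≠ D → G.1 ∈ ℬ := by
    intro G hG
    rcases List.mem_cons.mp G.2.1 with h | h
    · exact absurd h hG
    · exact h
  let toℬ : ∀ G : {G : E.IdealSheafData // G ∈ D :: ℬ ∧ D.subschemeι x ∈ G.support}, G.1 ≠ D →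
      {G : E.IdealSheafData // G ∈ ℬ ∧ D.subschemeι x ∈ G.support} := fun G hG => ⟨G.1, hmemℬ G hG, G.2.2⟩
  let labE : {G : E.IdealSheafData // G ∈ D :: ℬ ∧ D.subschemeι x ∈ G.support} → Fin (d + 1) := fun G =>
    if hG : G.1 = D then 0 else Fin.succ (lab (tr (toℬ G hG)))
  refine ⟨inferInstance, d + 1, Fin.cons z u', hcount, hspanE, ⟨labE, ?_, ?_⟩,
    fun h => absurd h (by rw [Scheme.IdealSheafData.support_top]; exact id)⟩
  · -- injectivity of the labels
    intro G G' hGG'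
    by_cases hG : G.1 = D <;> by_cases hG' : G'.1 = D
    · exact Subtype.ext (hG.trans hG'.symm)
    · exfalso; simp only [labE, dif_pos hG, dif_neg hG'] at hGG'; exact (Fin.succ_ne_zero _) hGG'.symm
    · exfalso; simp only [labE, dif_neg hG, dif_pos hG'] at hGG'; exact (Fin.succ_ne_zero _) hGG'
    · simp only [labE, dif_neg hG, dif_neg hG'] at hGG'
      have h1 := htr_inj (hlab (Fin.succ_injective _ hGG'))
      exact Subtype.ext (congrArg (fun G => G.1) h1 : (toℬ G hG).1 = (toℬ G' hG').1)
  · -- the stalks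
    intro G
    by_cases hG : G.1 = D
    · simp only [labE, dif_pos hG, Fin.cons_zero, hG]; exact hDx
    · simp only [labE, dif_neg hG, Fin.cons_succ]
      rw [hu'lab]; exact hf (toℬ G hG)

end DepthLegal

end Summit.ResolutionOfSingularities.ResolutionOfSingularities.Theorems

end
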